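import Summits.NavierStokesRegularity.NavierStokesRegularity.Theorems.RungBlowupCofinal.Negative.MeanWaveFoldRange
import Summits.NavierStokesRegularity.FluidComputer.AngularGalerkinLadderDivergence
import Summits.NavierStokesRegularity.FluidComputer.AngularGalerkinLadderRotation
import HarnessLib

/-!
# Sectoral waves on the angular Galerkin ladder: the `so(3)` relations of the generators,
# `J_a` commutes with the Casimir cut, and an `L`-fold wave band-limited to degree `L` is an exact
# top-degree eigenfield orthogonal to all lower rungs
# (route `AngularGalerkinLadder`, crux K1 `RungBlowupCofinal`; Negative lane, theorems only)

Negative-lane bookkeeping for `stmt-NavierStokesRegularity-19959` (K1 of route №8), cell ns-blowup,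
refuter5 (K5-75), continuing `MeanWaveFoldRange` (K5-74) about the line
`Cruxes/RungBlowupCofinal/Lines/qlwave.lean` (mean–wave rung profiles `U = V + W`, `W` an `n`-fold
azimuthal wave, `L < 2n`; fold range `n ∈ (L/2, L]` by K5-74). Nothing here asserts a Theses
declaration; no definition, no named fact. WHAT THIS IS NOT: not Navier–Stokes evidence — kinematic
identities for smooth / band-limited vector fields on `ℝ³` and their angular-momentum generators
`J_a u = e_a × u − (e_a × x)·∇u`; no rung dynamics, no profile is constructed or excluded beyond the
stated kinematic box.

## Content

* `angGen_angGen_sub_angGen_angGen` — the commutation relations `[J_a, J_b] = J_{e_a × e_b}`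
  (`= Σ_i (e_a × e_b)_i J_i`, `angGen_angGen_sub_angGen_angGen_eq_sum`), for smooth fields, from the
  tree's `fderiv_angGen` and the symmetry of second derivatives.
* **`angGen_casimir_comm`, `angGen_bandDefect_comm`, `isBandLimited_angGen`** — every generator
  commutes with the Casimir `𝒞 = −Σ J_a²` and with every band defect `∏_{j ≤ L}(𝒞 − j(j+1))`; hence
  `J_a` preserves `IsBandLimited L` (missing so far from the ladder's API: the Coriolis letter
  `α J₃ W` of the line stays in the band, and wave relations pass to band defects,
  `wave_bandDefect`).
* `casimir_bandDefect_of_isBandLimited_succ`, `isBandLimited_sub_top` — the top isotypic splitting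
  of a field band-limited of degree `≤ K+1` (top band defect = `𝒞`-eigenfield of eigenvalue
  `(K+1)(K+2)`; the remainder is band-limited of degree `≤ K`), as standalone lemmas.
* **`casimir_eq_smul_of_sectoral`** — SECTORAL SHARPENING of K5-74: a field band-limited of degree
  `≤ L`, `1 ≤ L`, which is an `L`-fold azimuthal wave (`J₃(J₃W) = −L²W`, the letter of
  `Qlwave.IsAzimuthalWave L W`) is an exact eigenfield `𝒞W = L(L+1)W`; consequently every band
  defect acts on it by an explicit scalar (`bandDefect_eq_smul_of_sectoral`) and
  **`isCobandLimited_pred_of_sectoral`**: `W` is `L²`-orthogonal to every compactly supported field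
  band-limited of degree `≤ L−1`.

Reading for the line: with K5-74 the witnesses of `stub_meanwave_profiles_cofinal` /
`stub_meanwave_rung_four` have fold `n ∈ (L/2, L]`; in the sectoral case `n = L` (the cstrat's
large-`L` equatorial-ring heuristics, qlwave.lean l.199) the wave part is confined to the top
isotype of rung `L`: `𝒞W = L(L+1)W`, `W ⊥ {band ≤ L−1}` — so a sectoral rung-`L` profile sees the
lower rungs only through its zonal part `V`, and `W` cannot be continued from a rung-`(L−1)` object.
[cite: BullardGellman1954] (vector spherical harmonics: `𝒞 = j(j+1)`, `|m| ≤ j`, `|m| = j`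
sectoral — here in the tree's projection-free typing).
-/

noncomputable section

namespace Summit.NavierStokesRegularity.AngularGalerkinLadderSectoralWave

open Set Function MeasureTheory
open scoped ContDiff RealInnerProductSpace
open Literature.Analysis.FluidPDE
open Summit.NavierStokesRegularity.FluidComputer
open Summit.NavierStokesRegularity.FluidComputer.AngularLadder
open Summit.NavierStokesRegularity.AngularGalerkinLadderMeanWaveFoldRange

variable {u w : EuclideanSpace ℝ (Fin 3) → EuclideanSpace ℝ (Fin 3)} {L : ℕ}

/-! ## §1 The commutation relations of the generators -/

/-- Jacobi in the form `a × (b × z) − b × (a × z) = (a × b) × z`. [folklore] -/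
theorem cross_cross_sub_cross_cross (a b z : EuclideanSpace ℝ (Fin 3)) :
    cross a (cross b z) - cross b (cross a z) = cross (cross a b) z := by
  ext i
  fin_cases i <;> simp [cross, cross_apply] <;> ring

/-- **The `so(3)` commutation relations of the generators**: for smooth `u`,
`J_a(J_b u) − J_b(J_a u)` is the generator along `e_a × e_b`, i.e.
`(e_a × e_b) × u(x) − Du(x)((e_a × e_b) × x)` (the second derivatives cancel by the symmetry of
`D²u`, the pointwise parts by Jacobi). [folklore] -/
theorem angGen_angGen_sub_angGen_angGen (hu : ContDiff ℝ ∞ u) (a b : Fin 3)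
    (x : EuclideanSpace ℝ (Fin 3)) :
    angGen a (angGen b u) x - angGen b (angGen a u) x =
      cross (cross (axis a) (axis b)) (u x) - fderiv ℝ u x (cross (cross (axis a) (axis b)) x) := by
  have hD2 : ∀ v z, fderiv ℝ (fderiv ℝ u) x v z = fderiv ℝ (fderiv ℝ u) x z v :=
    fderiv_fderiv_symm hu x
  have hexp : ∀ a b : Fin 3, angGen a (angGen b u) x =
      crossCLM (axis a) (crossCLM (axis b) (u x)) -
        crossCLM (axis a) (fderiv ℝ u x (crossCLM (axis b) x)) -
        crossCLM (axis b) (fderiv ℝ u x (crossCLM (axis a) x)) +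
        fderiv ℝ u x (crossCLM (axis b) (crossCLM (axis a) x)) +
        fderiv ℝ (fderiv ℝ u) x (crossCLM (axis a) x) (crossCLM (axis b) x) := by
    intro a b
    rw [show angGen a (angGen b u) x =
        crossCLM (axis a) (angGen b u x) - fderiv ℝ (angGen b u) x (crossCLM (axis a) x) from rfl,
      fderiv_angGen hu b x,
      show angGen b u x = crossCLM (axis b) (u x) - fderiv ℝ u x (crossCLM (axis b) x) from rfl]
    simp only [sub_apply, add_apply, ContinuousLinearMap.comp_apply, ContinuousLinearMap.flip_apply,
      map_sub]
    abel
  rw [hexp a b, hexp b a, hD2 (crossCLM (axis b) x) (crossCLM (axis a) x)]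
  simp only [crossCLM_apply]
  rw [← cross_cross_sub_cross_cross (axis a) (axis b) (u x),
    ← cross_cross_sub_cross_cross (axis a) (axis b) x, map_sub]
  abel

/-- `[J_a, J_b] = Σ_i (e_a × e_b)_i J_i` (the commutator as a combination of generators).
[folklore] -/
theorem angGen_angGen_sub_angGen_angGen_eq_sum (hu : ContDiff ℝ ∞ u) (a b : Fin 3)
    (x : EuclideanSpace ℝ (Fin 3)) :
    angGen a (angGen b u) x - angGen b (angGen a u) x =
      ∑ i : Fin 3, (cross (axis a) (axis b)) i • angGen i u x := by
  rw [sum_smul_angGen, angGen_angGen_sub_angGen_angGen hu a b x]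

/-- `(e_a × e_b)_i` is antisymmetric in `(b, i)` (it is the sign `ε_{abi}`). [folklore] -/
theorem cross_axis_axis_apply_swap (a b i : Fin 3) :
    cross (axis a) (axis b) i = -cross (axis a) (axis i) b := by
  fin_cases a <;> fin_cases b <;> fin_cases i <;> simp [cross, cross_apply, axis]

/-- A symmetric family contracted against `(b, i) ↦ (e_a × e_b)_i` vanishes. [folklore] -/
theorem sum_sum_cross_axis_smul_eq_zero {V : Type*} [AddCommGroup V] [Module ℝ V]
    (S : Fin 3 → Fin 3 → V) (hS : ∀ b i, S b i = S i b) (a : Fin 3) :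
    ∑ b : Fin 3, ∑ i : Fin 3, (cross (axis a) (axis b)) i • S b i = 0 := by
  have h : ∑ b : Fin 3, ∑ i : Fin 3, (cross (axis a) (axis b)) i • S b i =
      -∑ b : Fin 3, ∑ i : Fin 3, (cross (axis a) (axis b)) i • S b i := by
    conv_lhs => rw [Finset.sum_comm]
    simp only [← Finset.sum_neg_distrib]  -- push the minus inside? we do it differently below
    refine Finset.sum_congr rfl fun b _ => Finset.sum_congr rfl fun i _ => ?_
    rw [cross_axis_axis_apply_swap a i b, hS i b, neg_smul]
  have h2 : (2 : ℝ) • (∑ b : Fin 3, ∑ i : Fin 3, (cross (axis a) (axis b)) i • S b i) = 0 := by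
    rw [two_smul]
    nth_rewrite 2 [h]
    exact add_neg_cancel _
  exact (smul_eq_zero.1 h2).resolve_left two_ne_zero

/-! ## §2 `J_a` commutes with the Casimir and with every band defect -/

/-- Linearity of `J_a` in the lambda form used below. [folklore] -/
theorem angGen_sub_smul {f g : EuclideanSpace ℝ (Fin 3) → EuclideanSpace ℝ (Fin 3)}
    (hf : Differentiable ℝ f) (hg : Differentiable ℝ g) (c : ℝ) (a : Fin 3) :
    angGen a (fun x => f x - c • g x) = fun x => angGen a f x - c • angGen a g x := by
  funext x
  have hD : fderiv ℝ (fun x => f x - c • g x) x = fderiv ℝ f x - c • fderiv ℝ g x :=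
    ((hf x).hasFDerivAt.sub ((hg x).hasFDerivAt.const_smul c)).fderiv
  simp only [angGen_eq, hD, map_sub, map_smul, sub_apply, smul_apply, smul_sub]
  abel

/-- Linearity of `J_a` over a pointwise difference. [folklore] -/
theorem angGen_fun_sub {f g : EuclideanSpace ℝ (Fin 3) → EuclideanSpace ℝ (Fin 3)}
    (hf : Differentiable ℝ f) (hg : Differentiable ℝ g) (a : Fin 3) :
    angGen a (fun x => f x - g x) = fun x => angGen a f x - angGen a g x := by
  have h := angGen_sub_smul hf hg 1 a
  simp only [one_smul] at h
  exact h

/-- `𝒞u = Σ_b (−1)•J_b(J_b u)` as functions (the shape `angGen_sum_smul` consumes). [folklore] -/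
theorem casimir_eq_sum_neg_smul (u : EuclideanSpace ℝ (Fin 3) → EuclideanSpace ℝ (Fin 3)) :
    casimir u = fun x => ∑ b : Fin 3, (-1 : ℝ) • angGen b (angGen b u) x := by
  funext x
  simp [casimir, Finset.sum_neg_distrib]

/-- **`J_a` commutes with the Casimir**: `J_a(𝒞u) = 𝒞(J_a u)` for smooth `u`
(`[J_a, Σ_b J_b²] = Σ_{b,i} (e_a × e_b)_i (J_iJ_b + J_bJ_i) = 0` by antisymmetry). [folklore] -/
theorem angGen_casimir_comm (hu : ContDiff ℝ ∞ u) (a : Fin 3) :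
    angGen a (casimir u) = casimir (angGen a u) := by
  have hJ : ∀ b, ContDiff ℝ ∞ (angGen b u) := fun b => contDiff_angGen hu b
  have hJJ : ∀ b c, ContDiff ℝ ∞ (angGen c (angGen b u)) := fun b c => contDiff_angGen (hJ b) c
  funext x
  rw [casimir_eq_sum_neg_smul u,
    angGen_sum_smul Finset.univ (fun _ => (-1 : ℝ)) (w := fun b => angGen b (angGen b u))
      (fun b _ => (hJJ b b).differentiable (by simp)) a]
  rw [show casimir (angGen a u) x = ∑ b : Fin 3, (-1 : ℝ) • angGen b (angGen b (angGen a u)) x from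
    congrFun (casimir_eq_sum_neg_smul (angGen a u)) x]
  rw [← sub_eq_zero, ← Finset.sum_sub_distrib]
  -- each summand: -(J_a J_b J_b u − J_b J_b J_a u)
  have hkey : ∀ b, angGen a (angGen b (angGen b u)) x - angGen b (angGen b (angGen a u)) x =
      ∑ i : Fin 3, (cross (axis a) (axis b)) i •
        (angGen i (angGen b u) x + angGen b (angGen i u) x) := by
    intro b
    have h1 := angGen_angGen_sub_angGen_angGen_eq_sum (hJ b) a b x
    -- J_b (J_a J_b u − J_b J_a u) = Σ_i c_i J_b J_i u
    have hfun : (fun y => angGen a (angGen b u) y - angGen b (angGen a u) y) =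
        fun y => ∑ i : Fin 3, (cross (axis a) (axis b)) i • angGen i u y :=
      funext fun y => angGen_angGen_sub_angGen_angGen_eq_sum hu a b y
    have h2 : angGen b (angGen a (angGen b u)) x - angGen b (angGen b (angGen a u)) x =
        ∑ i : Fin 3, (cross (axis a) (axis b)) i • angGen b (angGen i u) x := by
      have h3 := congrFun (angGen_fun_sub ((hJJ b a).differentiable (by simp))
        ((hJJ a b).differentiable (by simp)) b) x
      have h4 := congrFun (angGen_sum_smul Finset.univ (fun i => (cross (axis a) (axis b)) i)
        (w := fun i => angGen i u) (fun i _ => (hJ i).differentiable (by simp)) b) x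
      rw [← h3, hfun, h4]
    calc angGen a (angGen b (angGen b u)) x - angGen b (angGen b (angGen a u)) x
        = (angGen a (angGen b (angGen b u)) x - angGen b (angGen a (angGen b u)) x) +
            (angGen b (angGen a (angGen b u)) x - angGen b (angGen b (angGen a u)) x) := by abel
      _ = _ := by
          rw [h1, h2, ← Finset.sum_add_distrib]
          refine Finset.sum_congr rfl fun i _ => ?_
          rw [smul_add]
  have hsum : ∑ b : Fin 3, ((-1 : ℝ) • angGen a (angGen b (angGen b u)) x -
      (-1 : ℝ) • angGen b (angGen b (angGen a u)) x) =
      -∑ b : Fin 3, ∑ i : Fin 3, (cross (axis a) (axis b)) i •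
        (angGen i (angGen b u) x + angGen b (angGen i u) x) := by
    rw [← Finset.sum_neg_distrib]
    refine Finset.sum_congr rfl fun b _ => ?_
    rw [← hkey b, neg_one_smul, neg_one_smul]
    abel
  rw [hsum, sum_sum_cross_axis_smul_eq_zero _ (fun b i => add_comm _ _) a, neg_zero]

/-- `J_a` commutes with every band defect `∏_{j ≤ L}(𝒞 − j(j+1))`. [folklore] -/
theorem angGen_bandDefect_comm (hu : ContDiff ℝ ∞ u) (a : Fin 3) (L : ℕ) :
    angGen a (bandDefect L u) = bandDefect L (angGen a u) := by
  induction L with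
  | zero => exact angGen_casimir_comm hu a
  | succ L ih =>
      have hBs : ContDiff ℝ ∞ (bandDefect L u) := contDiff_bandDefect hu L
      have h1 : bandDefect (L + 1) u = fun x => casimir (bandDefect L u) x -
          (((L : ℝ) + 1) * ((L : ℝ) + 2)) • bandDefect L u x := rfl
      rw [h1, angGen_sub_smul ((contDiff_casimir hBs).differentiable (by simp))
        (hBs.differentiable (by simp)) _ a, angGen_casimir_comm hBs a, ih]
      rfl

/-- **Band-limited fields are stable under the generators**: `J_a` maps fields band-limited of
degree `≤ L` to fields band-limited of degree `≤ L` (so the Coriolis letter `α J₃ W` of the line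
stays in the band). [folklore] -/
theorem isBandLimited_angGen (hu : IsBandLimited L u) (a : Fin 3) :
    IsBandLimited L (angGen a u) := by
  refine ⟨contDiff_angGen hu.1 a, fun x => ?_⟩
  have h0 : bandDefect L u = 0 := funext hu.2
  rw [← angGen_bandDefect_comm hu.1 a L, h0, angGen_zero]
  rfl

/-! ## §3 Waves pass to band defects; the top isotypic splitting -/

/-- An azimuthal wave relation `J₃(J₃w) = −ν w` passes to every band defect of `w`. [folklore] -/
theorem wave_bandDefect (hW : ContDiff ℝ ∞ w) {ν : ℝ}
    (hwave : ∀ y, angGen 2 (angGen 2 w) y = -(ν • w y)) (k : ℕ) :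
    ∀ y, angGen 2 (angGen 2 (bandDefect k w)) y = -(ν • bandDefect k w y) := by
  have hfun : angGen 2 (angGen 2 w) = (-ν) • w := funext fun y => by
    rw [hwave y, Pi.smul_apply, neg_smul]
  intro y
  rw [angGen_bandDefect_comm hW 2 k, angGen_bandDefect_comm (contDiff_angGen hW 2) 2 k, hfun,
    bandDefect_smul hW (-ν) k, Pi.smul_apply, neg_smul]

/-- For `w` band-limited of degree `≤ K+1`, the band defect `w₁ := ∏_{j ≤ K}(𝒞 − j(j+1)) w` is a
`𝒞`-eigenfield of the top eigenvalue `(K+1)(K+2)`. [folklore] -/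
theorem casimir_bandDefect_of_isBandLimited_succ {K : ℕ} (hw : IsBandLimited (K + 1) w) :
    casimir (bandDefect K w) = (((K : ℝ) + 1) * ((K : ℝ) + 2)) • bandDefect K w := by
  funext x
  have h : casimir (bandDefect K w) x - (((K : ℝ) + 1) * ((K : ℝ) + 2)) • bandDefect K w x = 0 :=
    hw.2 x
  rw [sub_eq_zero] at h
  rw [h, Pi.smul_apply]

/-- **Top isotypic splitting**: for `w` band-limited of degree `≤ K+1`, removing the normalised top
band defect `w₁/∏_{j ≤ K}((K+1)(K+2) − j(j+1))` leaves a field band-limited of degree `≤ K`.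
[folklore] -/
theorem isBandLimited_sub_top {K : ℕ} (hw : IsBandLimited (K + 1) w) :
    IsBandLimited K (fun x => w x -
      (∏ j ∈ Finset.range (K + 1), ((((K : ℝ) + 1) * ((K : ℝ) + 2)) - (j : ℝ) * ((j : ℝ) + 1)))⁻¹ •
        bandDefect K w x) := by
  obtain ⟨p, hp⟩ : ∃ p : ℝ, p = ∏ j ∈ Finset.range (K + 1),
      ((((K : ℝ) + 1) * ((K : ℝ) + 2)) - (j : ℝ) * ((j : ℝ) + 1)) := ⟨_, rfl⟩
  rw [← hp]
  have hp0 : 0 < p := by rw [hp]; exact prod_casimirGap_pos K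
  have hws : ContDiff ℝ ∞ w := hw.1
  have hw₁s : ContDiff ℝ ∞ (bandDefect K w) := contDiff_bandDefect hws K
  have hB₁ : bandDefect K (bandDefect K w) = p • bandDefect K w := by
    rw [hp]
    exact bandDefect_eq_smul_of_casimir_eq hw₁s (casimir_bandDefect_of_isBandLimited_succ hw) K
  have hsm : ContDiff ℝ ∞ ((-p⁻¹) • bandDefect K w) := hw₁s.const_smul (-p⁻¹)
  have hfun : (fun x => w x - p⁻¹ • bandDefect K w x) = w + (-p⁻¹) • bandDefect K w := by
    funext x
    simp only [Pi.add_apply, Pi.smul_apply, Pi.neg_apply, neg_smul, sub_eq_add_neg]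
  rw [hfun]
  refine ⟨hws.add hsm, fun x => ?_⟩
  rw [bandDefect_add hws hsm K, bandDefect_smul hw₁s (-p⁻¹) K, hB₁]
  simp only [Pi.add_apply, Pi.smul_apply, smul_smul]
  rw [show -p⁻¹ * p = -1 by rw [neg_mul, inv_mul_cancel₀ hp0.ne'], neg_one_smul, add_neg_cancel]

/-! ## §4 Sectoral waves are exact top-degree Casimir eigenfields -/

/-- **Sectoral waves are exact top-degree eigenfields**: a field band-limited of degree `≤ L`
(`1 ≤ L`) which is an `L`-fold azimuthal wave, `J₃(J₃w) = −L² w` (the letter of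
`Qlwave.IsAzimuthalWave L w`), satisfies `𝒞w = L(L+1) w` — its component of degree `≤ L−1` is an
`L`-fold wave band-limited of degree `L−1 < L`, hence zero by
`eq_zero_of_isBandLimited_of_azimuthalWave`. [cite: BullardGellman1954] (vector spherical
harmonics, `|m| ≤ j`; here projection-free). -/
theorem casimir_eq_smul_of_sectoral (hW : IsBandLimited L w)
    (hwave : ∀ y, angGen 2 (angGen 2 w) y = -(((L : ℝ) ^ 2) • w y)) (hL : 1 ≤ L) :
    casimir w = ((L : ℝ) * ((L : ℝ) + 1)) • w := by
  obtain ⟨K, rfl⟩ : ∃ K, L = K + 1 := ⟨L - 1, by omega⟩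
  obtain ⟨c, hc⟩ : ∃ c : ℝ, c = (∏ j ∈ Finset.range (K + 1),
      ((((K : ℝ) + 1) * ((K : ℝ) + 2)) - (j : ℝ) * ((j : ℝ) + 1)))⁻¹ := ⟨_, rfl⟩
  have hws : ContDiff ℝ ∞ w := hW.1
  have hsplit : IsBandLimited K (fun x => w x - c • bandDefect K w x) := by
    rw [hc]; exact isBandLimited_sub_top hW
  obtain ⟨w₁, hw₁⟩ : ∃ w₁ : EuclideanSpace ℝ (Fin 3) → EuclideanSpace ℝ (Fin 3),
      w₁ = bandDefect K w := ⟨_, rfl⟩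
  have hw₁s : ContDiff ℝ ∞ w₁ := hw₁ ▸ contDiff_bandDefect hws K
  have hC₁ : casimir w₁ = (((K : ℝ) + 1) * ((K : ℝ) + 2)) • w₁ := by
    rw [hw₁]; exact casimir_bandDefect_of_isBandLimited_succ hW
  have hwave₁ : ∀ y, angGen 2 (angGen 2 w₁) y = -((((K + 1 : ℕ) : ℝ) ^ 2) • w₁ y) := by
    rw [hw₁]; exact wave_bandDefect hws hwave K
  rw [← hw₁] at hsplit
  -- the remainder is a `(K+1)`-fold wave, band-limited of degree `K < K+1`, hence zero
  have hJw : Differentiable ℝ (angGen 2 w) := (contDiff_angGen hws 2).differentiable (by simp)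
  have hJw₁ : Differentiable ℝ (angGen 2 w₁) := (contDiff_angGen hw₁s 2).differentiable (by simp)
  have hwave₂ : ∀ y, angGen 2 (angGen 2 (fun x => w x - c • w₁ x)) y =
      -((((K + 1 : ℕ) : ℝ) ^ 2) • (fun x => w x - c • w₁ x) y) := by
    intro y
    rw [angGen_sub_smul (hws.differentiable (by simp)) (hw₁s.differentiable (by simp)) c 2,
      angGen_sub_smul hJw hJw₁ c 2]
    simp only [hwave y, hwave₁ y, smul_sub, smul_neg]
    rw [smul_comm c ((((K + 1 : ℕ) : ℝ)) ^ 2) (w₁ y)]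
    abel
  have hzero := eq_zero_of_isBandLimited_of_azimuthalWave hsplit hwave₂ (Nat.lt_succ_self K)
  have hwc : w = c • w₁ := by
    funext y
    have hy := congrFun hzero y
    simp only [Pi.zero_apply, sub_eq_zero] at hy
    rw [hy, Pi.smul_apply]
  rw [hwc, casimir_smul hw₁s c, hC₁, smul_comm]
  congr 1
  push_cast
  ring

/-- On a sectoral wave every band defect acts by the explicit scalar `∏_{j ≤ k}(L(L+1) − j(j+1))`.
[folklore] -/
theorem bandDefect_eq_smul_of_sectoral (hW : IsBandLimited L w)
    (hwave : ∀ y, angGen 2 (angGen 2 w) y = -(((L : ℝ) ^ 2) • w y)) (hL : 1 ≤ L) (k : ℕ) :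
    bandDefect k w =
      (∏ j ∈ Finset.range (k + 1), ((L : ℝ) * ((L : ℝ) + 1) - (j : ℝ) * ((j : ℝ) + 1))) • w :=
  bandDefect_eq_smul_of_casimir_eq hW.1 (casimir_eq_smul_of_sectoral hW hwave hL) k

/-- **A sectoral wave is `L²`-orthogonal to every compactly supported field band-limited of degree
`≤ L−1`** (`IsCobandLimited (L-1) w`): the degree-`(L−1)` band defect acts on `w` by a positive
scalar and is symmetric (`integral_inner_bandDefect_comm`). Reading for the line
`Cruxes/RungBlowupCofinal/Lines/qlwave.lean`: a sectoral witness `(n = L)` of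
`stub_meanwave_profiles_cofinal` / `stub_meanwave_rung_four` has its wave part `W` in the exact top
isotype of rung `L` — orthogonal to everything the lower rungs carry. [folklore] -/
theorem isCobandLimited_pred_of_sectoral (hW : IsBandLimited L w)
    (hwave : ∀ y, angGen 2 (angGen 2 w) y = -(((L : ℝ) ^ 2) • w y)) (hL : 1 ≤ L) :
    IsCobandLimited (L - 1) w := by
  obtain ⟨K, rfl⟩ : ∃ K, L = K + 1 := ⟨L - 1, by omega⟩
  rw [Nat.add_sub_cancel]
  intro ψ hψ hψc
  obtain ⟨p, hp⟩ : ∃ p : ℝ, p = ∏ j ∈ Finset.range (K + 1),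
      ((((K : ℝ) + 1) * ((K : ℝ) + 2)) - (j : ℝ) * ((j : ℝ) + 1)) := ⟨_, rfl⟩
  have hp0 : 0 < p := by rw [hp]; exact prod_casimirGap_pos K
  have hB : bandDefect K w = p • w := by
    rw [bandDefect_eq_smul_of_sectoral hW hwave hL K, hp]
    congr 1
    refine Finset.prod_congr rfl fun j _ => ?_
    push_cast
    ring
  have hcomm := integral_inner_bandDefect_comm hW.1 K hψ.1 hψc
  have h0 : ∀ x, bandDefect K ψ x = 0 := hψ.2
  simp only [h0, inner_zero_right, integral_zero, hB, Pi.smul_apply, real_inner_smul_left] at hcomm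
  rw [integral_const_mul] at hcomm
  exact (mul_eq_zero.1 hcomm).resolve_left hp0.ne'

end Summit.NavierStokesRegularity.AngularGalerkinLadderSectoralWave

end
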